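import Summits.ResolutionOfSingularities.KangarooAtlas.MizutaniOperatorBasis
import Mathlib.Algebra.MvPolynomial.PDeriv
import HarnessLib

/-!
# The truncated polynomial ring `K[u]/(u_i^q)` — partial derivatives, and the Taylor morphism intertwines them

Cell topic `Summits/ResolutionOfSingularities/KangarooAtlas` (pub-rosobs); namespace
`Summit.ResolutionOfSingularities.KangarooAtlas.Mizutani`.  Part of the Lean transcription of Mizutani 1973 §2
around the in-house note MIZUTANI-PROOF-g59 (AI-written, AI-audited; *AI review is weaker than expert review*; not a
resolution theorem).  Infrastructure for the base change `K ⊗_L K ≅ K[u]/(u_i^q)` used in the equality case of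
Mizutani's Lemma 2.9: the partial derivatives `∂/∂u_i` descend to the truncated polynomial ring
(`q = p^e`, characteristic `p`: `∂(u_i^q) = q u_i^{q−1} = 0`), and the Taylor morphism `tau : K → K[u]/(u^q)`,
`a_i ↦ a_i + u_i`, satisfies `∂/∂u_i ∘ tau = tau ∘ D^{(e_i)}` (the Hasse–Schmidt derivation of the `p`-basis):

* `pderiv_mem_boxIdeal` — `boxIdeal` is stable under `∂/∂u_i`;
* `boxDeriv i : BoxQuot (Fin s) K q →ₗ[K] BoxQuot` — the descended derivation, `boxDeriv_mk`, Leibniz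
  (`boxDeriv_mul`), values on constants and generators, `coeff_truncQ_boxDeriv` (coefficient formula);
* `boxDer i` — the same as a Mathlib `Derivation K B B`;
* **`IsRootTower.boxDeriv_tau`** — `∂_i (tau y) = tau (D^{(e_i)} y)`.

References: [EGAIV4] Thm. 16.11.2; [Mizutani1973HironakaGroupSchemes] Lemma 2.9 (proof).
-/

open MvPolynomial Literature.AlgebraicGeometry.Resolution

namespace Summit.ResolutionOfSingularities.KangarooAtlas.Mizutani

section BoxDerivation

variable {K : Type*} [Field K] {s p e : ℕ} [CharP K p]

/-- In characteristic `p`, a natural number `n` with `q = p^e ≤ n < q + 1`, i.e. `n = q`, is `0` in `K`; more usefully: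
if `q ≤ n` and `n - 1 < q` then `(n : K) = 0`. [folklore] -/
theorem natCast_eq_zero_of_pred_lt (he : 1 ≤ e) {n : ℕ} (hn : p ^ e ≤ n) (hn' : n - 1 < p ^ e) : (n : K) = 0 := by
  have hnq : n = p ^ e := by omega
  rw [hnq, Nat.cast_pow, CharP.cast_eq_zero K p, zero_pow (by omega)]

/-- **`boxIdeal` is stable under the partial derivatives** (`q = p^e`, `e ≥ 1`, characteristic `p`).
[cite: EGAIV4, Thm. 16.11.2 (the truncated Taylor target is a quotient by a differential ideal in char p)] -/
theorem pderiv_mem_boxIdeal (he : 1 ≤ e) (i : Fin s) {f : MvPolynomial (Fin s) K}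
    (hf : f ∈ boxIdeal (Fin s) K (p ^ e)) : pderiv i f ∈ boxIdeal (Fin s) K (p ^ e) := by
  classical
  rw [mem_boxIdeal_iff] at hf ⊢
  intro M hM hbox
  rw [mem_support_iff, coeff_pderiv] at hM
  have hM' : M + Finsupp.single i 1 ∈ f.support := by
    rw [mem_support_iff]; intro h0; exact hM (by rw [h0, zero_mul])
  have hnot := hf _ hM'
  -- the only exponent that can leave the box is `i`, and then `M i + 1 = q`
  apply hnot
  intro j
  rw [Finsupp.add_apply, Finsupp.single_apply]
  split_ifs with hji
  · subst hji
    by_contra hge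
    push Not at hge
    have hcast : ((M i + 1 : ℕ) : K) = 0 :=
      natCast_eq_zero_of_pred_lt (K := K) he hge (by have := hbox i; omega)
    exact hM (by rw [← Nat.cast_succ, hcast, mul_zero])
  · have := hbox j; omega

variable (K s) in
/-- **The partial derivative `∂/∂u_i` on `K[u]/(u^q)`** (`q = p^e`, `e ≥ 1`), as a `K`-linear map: the box section,
then `pderiv i`, then the quotient map. [cite: EGAIV4, Thm. 16.11.2] -/
noncomputable def boxDeriv (q : ℕ) (i : Fin s) : BoxQuot (Fin s) K q →ₗ[K] BoxQuot (Fin s) K q :=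
  (Ideal.Quotient.mkₐ K (boxIdeal (Fin s) K q)).toLinearMap ∘ₗ (pderiv i).toLinearMap ∘ₗ truncQ (Fin s) K q

/-- `∂_i [f] = [∂f/∂u_i]`. [folklore] -/
theorem boxDeriv_mk (he : 1 ≤ e) (i : Fin s) (f : MvPolynomial (Fin s) K) :
    boxDeriv K s (p ^ e) i (Ideal.Quotient.mk _ f) = Ideal.Quotient.mk _ (pderiv i f) := by
  unfold boxDeriv
  rw [LinearMap.comp_apply, LinearMap.comp_apply, truncQ_mk]
  show Ideal.Quotient.mk _ (pderiv i (trunc (p ^ e) f)) = Ideal.Quotient.mk _ (pderiv i f)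
  rw [Ideal.Quotient.eq, ← map_sub]
  refine pderiv_mem_boxIdeal he i ?_
  rw [← neg_sub, Ideal.neg_mem_iff]
  exact sub_trunc_mem_boxIdeal (Fin s) K (p ^ e) f

/-- **Leibniz rule** for `∂_i` on `K[u]/(u^q)`. [folklore] -/
theorem boxDeriv_mul (he : 1 ≤ e) (i : Fin s) (z z' : BoxQuot (Fin s) K (p ^ e)) :
    boxDeriv K s (p ^ e) i (z * z') = boxDeriv K s (p ^ e) i z * z' + z * boxDeriv K s (p ^ e) i z' := by
  obtain ⟨f, rfl⟩ := Ideal.Quotient.mk_surjective z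
  obtain ⟨g, rfl⟩ := Ideal.Quotient.mk_surjective z'
  rw [← map_mul, boxDeriv_mk he, boxDeriv_mk he, boxDeriv_mk he, pderiv_mul, map_add, map_mul, map_mul]

/-- `∂_i` kills the constants `[C c]`. [folklore] -/
theorem boxDeriv_C (he : 1 ≤ e) (i : Fin s) (c : K) :
    boxDeriv K s (p ^ e) i (Ideal.Quotient.mk _ (C c)) = 0 := by
  rw [boxDeriv_mk he, pderiv_C, map_zero]

/-- `∂_i [u_j] = δ_{ij}`. [folklore] -/
theorem boxDeriv_X (he : 1 ≤ e) (i j : Fin s) :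
    boxDeriv K s (p ^ e) i (Ideal.Quotient.mk _ (X j)) = if i = j then 1 else 0 := by
  classical
  rw [boxDeriv_mk he]
  by_cases hij : i = j
  · subst hij
    rw [if_pos rfl, pderiv_X_self, map_one]
  · rw [if_neg hij, pderiv_X_of_ne (Ne.symm hij), map_zero]

/-- `∂_i` commutes with left multiplication by constants. [folklore] -/
theorem boxDeriv_C_mul (he : 1 ≤ e) (i : Fin s) (c : K) (z : BoxQuot (Fin s) K (p ^ e)) :
    boxDeriv K s (p ^ e) i (Ideal.Quotient.mk _ (C c) * z) = Ideal.Quotient.mk _ (C c) * boxDeriv K s (p ^ e) i z := by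
  rw [boxDeriv_mul he, boxDeriv_C he, zero_mul, zero_add]

/-- **Coefficient formula**: `coeff_M (∂_i z) = (M_i + 1) · coeff_{M + e_i} z` on box representatives (for `M` in the box;
when `M + e_i` leaves the box both sides vanish). [folklore] -/
theorem coeff_truncQ_boxDeriv (he : 1 ≤ e) (i : Fin s) (z : BoxQuot (Fin s) K (p ^ e)) (M : Fin s →₀ ℕ)
    (hM : InBox (p ^ e) M) :
    coeff M (truncQ (Fin s) K (p ^ e) (boxDeriv K s (p ^ e) i z)) =
      coeff (M + Finsupp.single i 1) (truncQ (Fin s) K (p ^ e) z) * (M i + 1) := by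
  conv_lhs => rw [← mk_truncQ z, boxDeriv_mk he, truncQ_mk, coeff_trunc, if_pos hM, coeff_pderiv]

variable (K s) in
/-- `∂/∂u_i` as a Mathlib `Derivation` of the `K`-algebra `K[u]/(u^q)`. [folklore] -/
noncomputable def boxDer (he : 1 ≤ e) (i : Fin s) :
    Derivation K (BoxQuot (Fin s) K (p ^ e)) (BoxQuot (Fin s) K (p ^ e)) where
  toLinearMap := boxDeriv K s (p ^ e) i
  map_one_eq_zero' := by
    show boxDeriv K s (p ^ e) i 1 = 0
    rw [← (Ideal.Quotient.mk (boxIdeal (Fin s) K (p ^ e))).map_one, ← C_1, boxDeriv_C he]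
  leibniz' z z' := by
    show boxDeriv K s (p ^ e) i (z * z') = z • boxDeriv K s (p ^ e) i z' + z' • boxDeriv K s (p ^ e) i z
    rw [boxDeriv_mul he, smul_eq_mul, smul_eq_mul]
    ring

/-- `boxDer` unfolds to `boxDeriv`. [folklore] -/
theorem boxDer_apply (he : 1 ≤ e) (i : Fin s) (z : BoxQuot (Fin s) K (p ^ e)) :
    boxDer K s he i z = boxDeriv K s (p ^ e) i z := rfl

end BoxDerivation

/-! ### The Taylor morphism intertwines `∂/∂u_i` with `D^{(e_i)}` -/

section Taylor

universe u

variable {L K : Type u} [Field L] [Field K] [Algebra L K] {s p e : ℕ} [hp : Fact p.Prime] [CharP K p]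
  {x : Fin s → L} {a : Fin s → K}

/-- **`∂_i (tau y) = tau (D^{(e_i)} y)`**: the Taylor morphism `y ↦ Σ_T (D^{(T)} y) u^T` intertwines the partial derivative
in `u_i` with the Hasse–Schmidt derivation `D^{(e_i)}` (`D^{(T)} D^{(e_i)} = (T_i + 1) D^{(T + e_i)}`).
[cite: EGAIV4, Thm. 16.11.2 ((16.11.2.2) iterativity of the Taylor coefficients)] -/
theorem IsRootTower.boxDeriv_tau (h : IsRootTower L K (p ^ e) x a) (he : 1 ≤ e) (i : Fin s) (y : K) :
    boxDeriv K s (p ^ e) i (h.tau y) = h.tau (h.hsD (Finsupp.single i 1) y) := by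
  classical
  -- compare box representatives coefficientwise
  rw [← mk_truncQ (boxDeriv K s (p ^ e) i (h.tau y)), ← mk_truncQ (h.tau (h.hsD (Finsupp.single i 1) y))]
  congr 1
  refine MvPolynomial.ext _ _ fun M => ?_
  by_cases hM : InBox (p ^ e) M
  · rw [coeff_truncQ_boxDeriv he i _ M hM, ← h.hsD_apply, ← h.hsD_apply, h.hsD_hsD, mul_comm]
    congr 1
    have hm : mchoose (M + Finsupp.single i 1) (Finsupp.single i 1) = M i + 1 := by
      rw [mchoose_eq_prod, Finset.prod_eq_single i]
      · rw [Finsupp.add_apply, Finsupp.single_eq_same, Nat.choose_one_right]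
      · intro j _ hji
        rw [Finsupp.add_apply, Finsupp.single_apply, if_neg (Ne.symm hji), add_zero, Nat.choose_zero_right]
      · intro hi; exact absurd (Finset.mem_univ i) hi
    rw [hm, Nat.cast_add, Nat.cast_one]
  · -- outside the box both coefficients vanish
    have h0 : ∀ z : BoxQuot (Fin s) K (p ^ e), coeff M (truncQ (Fin s) K (p ^ e) z) = 0 := fun z => by
      by_contra hne
      exact hM (inBox_of_mem_support_truncQ z (mem_support_iff.mpr hne))
    rw [h0, h0]

end Taylor

end Summit.ResolutionOfSingularities.KangarooAtlas.Mizutani
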